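import Literature.MathematicalPhysics.QuantumFieldTheory.Balaban1983to89.B8Thm2TorusKnitOfCubeData
import Literature.MathematicalPhysics.QuantumFieldTheory.Balaban1983to89.B8Thm2TorusMemberCatalogueThresholds

/-!
# `Balaban1983to89.B8Thm2TorusKnitOfCubeDataCatalogued` — sub-row G-B8-T2S, file G2: [B8] THM 2 ON `T_η` FOR `SU(N)` FROM THE PER-CUBE (3.35) DATA AND THE
# (B)-LINES, THE MEMBER CATALOGUE DISCHARGED — p33's FILE 16 (`B8Thm2TorusKnitOfCubeData`) re-issued with print's quantifier order on the thresholds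
# ([B9] Thm 3.1 p. 397 «There exist constants M₁, … such that for M ≥ M₁», [4] Lemma 2.1 p. 234 «for RM satisfying (2.59)» — the thresholds FIRST, the
# lattices after), composed with the threshold catalogue G1 (`B8Thm2TorusMemberCatalogueThresholds`)

statement-level skeleton of published theorems with citation tags; proofs where landed; nothing here is a claim about the
Yang–Mills mass gap

T. Bałaban, *Spaces of regular gauge field configurations on a lattice and gauge fixing conditions*, Commun. Math. Phys. **99** (1985) 75–102
[`Balaban1985RegularSpaces`, "[B8]"]: Thm 2 p. 83, (1.33)–(1.39) pp. 82–83, p. 77 («Ω_j = T_η for j = 0,1,…,l»), p. 76 («G = SU(N)»), Prop. 3 (1.59) p. 86.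
T. Bałaban, *Propagators for lattice gauge theories in a background field*, Commun. Math. Phys. **99** (1985) 389–434 [`Balaban1985BackgroundPropagators`, "[B9]"]:
Thm 3.1 (3.42) p. 397 («There exist constants M₁, δ₀ > 0, B₀ … for M ≥ M₁»), Thm 3.2 (3.48) p. 398, (3.35)–(3.37) p. 396, Thm 3.7 pp. 409–410 («for M sufficiently
large»), Thm 3.9 p. 413.  [4] = T. Bałaban, *Propagators and renormalization transformations for lattice gauge theories. II*, Commun. Math. Phys. **96** (1984)
223–250 [`Balaban1984PropagatorsII`]: (2.1)–(2.4) p. 224, Lemma 2.1 (2.59)–(2.61) pp. 233–234.  T. Bałaban, *Averaging operations for lattice gauge theories*,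
Commun. Math. Phys. **98** (1985) 17–51 [`Balaban1985Averaging`, "[B7]"]: (4) p. 18, Prop. 2 p. 26.

WHY.  FILE 16 (p33 g100, p656834) displays three families: (i) a member catalogue `memF ιBF` meeting thresholds `M₀, T₀, N₀`, (ii) per-cube (3.35) data, (iii)
the (B)-lines — but takes `memF ιBF` as INPUTS before producing `∃ M₀ T₀ N₀`, so no catalogue can be chosen against the thresholds.  Print's order is the
other one (the constants `M₁`, `R` of [B9] Thm 3.1 ∕ [4] Lemma 2.1 are fixed first; the sequence of lattices is arbitrary afterwards), and FILE 16's PROOF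
has that order: §1 re-issues FILE 16 §1 with `∃ a₁ a₀′ M₀ T₀ N₀, ∀ e_s memF ιBF` (proof VERBATIM, binders moved); §2 plugs G1's catalogue
`exists_catalogueF16` (members of constant level `n`, nominal index `n + 1`, big blocks `M_h = L^a` above all three thresholds, `e_s = 1`) and passes to the
Setup-torus objects: the catalogue is DISCHARGED, the per-cube data are displayed MEMBER-GENERICALLY (for every member of the catalogue's shape — the form
in which a supplier from [B8] Prop. 6 would prove them), the (B)-lines unchanged, under the located volume threshold `k + k₀ ≤ m + K`.

WHAT IS PROVED (kernel; 0 `def`, 0 `… : Prop` fact, 0 sorry; standard axioms).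
* §1 ★★★★ `thm2TorusAt_specialUnitary_ofCubeData'` — FILE 16 §1 with the binder order `∃ a₁ a₀′ M₀ T₀ N₀, ∀ e_s memF ιBF, ∀ c_L …` (statement otherwise
  token-identical; proof = FILE 16's).
* §2 ★★★★ `thm2SetupSUAt_ofCubeData_catalogued_exists` — for `1 ≤ N ≤ 25`, `d + 1 ≥ 2`, odd `L = ℓ + 1 ≥ 5`, band `0 < b₀ ≤ b₁`, (B)-line constants `B₀`
  (`2 ≤ 5(d+1)LB₀`), `B₀β`, `c_B9 > 0`, `β_H`, `len`, a real basis `b` of `M_N(ℂ)` with coordinate bound `M₂`, scalar walk data `Rr, Hp`: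
  `∃ a₁ > 0, ∃ a₀′ > 0, ∃ a k₀` (`L^a ≥ 8`), `∀ c_L > 0` with `c_L·L² < a₀′`, `∃ B₁ B₂ c₁ > 0`, for EVERY `m K k η` with `1 ≤ k`, `k + k₀ ≤ m + K`, `η > 0`
  (`P₀ = 2L^{m+K}`): [per-cube (3.35) data for `bgY i U₀` at EVERY member `i` of the shape (constant level `n ≤ k`, `i.k = n + 1`, `M_h = L^a`, `c_f = L^{n+1}`,
  period `P₀`) and every `SU(N)`-valued `P₀`-periodic `U₀ ∈ 𝔄_n(T_η, α₀)`, `α₀ ≤ c_L` — FILE 16's twelve clauses verbatim] → [(B)-lines `B9P3PerAt` at all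
  `m′ ≤ k`] → `Thm2SetupSUAt (PV d ℓ m K hd hL) N k η 0 B₁ B₂ c₁ len (fun _ => True)`.

HONEST SCOPE.  §1 is FILE 16's proof re-run (composition of FILE 15, A5, A9 BY NAME); §2 is bookkeeping over §1 + G1 + `thm2SetupSUAt_of_thm2TorusAt`; NO
estimate of [B8] ∕ [B9] ∕ [4] is proved in this file; the two arrows' antecedents are displayed and inhabited by nothing here (the per-cube (3.35) data: [B8]
p. 82 «U₀ satisfies the regularity condition (3.35) in [4] … eventually we will drop it out» — Prop. 6's business; the (B)-lines: Prop. 3 (1.59)); located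
volume threshold `k + k₀ ≤ m + K`; DESIGN constant `B₁ = 5(d+1)LB₀(1 + 11(d+1)²) + 1` as in FILE 16 §2; count-neutral; `stub_PV3A` NOT discharged; nothing
continuum ∕ ℝ⁴ ∕ OS ∕ mass-gap ∕ Clay — the Yang–Mills mass gap is NOT proved by any of this.  No `sorry`, no `axiom`, no `def`, no `instance`, no `notation`.
NEW file; nothing landed is modified (FILE 16 stays as the catalogue-displayed form).  Cell `lit-balaban`, seat `lit-balaban-t2s-1` gen 9, 2026-08-28;
`--supports stmt-QuantumFields-19200`.
-/

noncomputable section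

open scoped BigOperators

namespace Literature.MathematicalPhysics.QuantumFieldTheory.Balaban1983to89.B8Thm2TorusKnitOfCubeDataCatalogued

open Node00 B6KLevelCensusIndexV1 B9Eq39Adjoint
open B7Prop1Explicit renaming Site → LSite
open B7Prop1Explicit (e)
open B7Prop2Explicit (unitaryUnits AvgClosed pdev C0 c2' C0_pos c2'_pos)
open B4PartitionUnity22 (thetaProf D1)
open B6Cover236MultiLevelBlocks (cubes)
open B6GlobalChartV1 (PV boxEquiv)
open B6Ineq2142KLevelV1 (β)
open B6RandomWalk (c1_nonneg)
open B9BackgroundsKLevelV1 (shiftsV1)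
open B9Eq360DeltaPrimeAY (AfldY)
open B9CubeGeometryInputs (RM1)
open B9GeoNormsKLevelV1 (geo9K)
open B9RWSums347DefiniteFaces (exp261)
open B9Ineq349SiteComposite (etaS_pos)
open B9Cor36CubeCutoffs (SC NearC)
open B8Ineq132 (InAk)
open B12Ineq417Flat (shiftCfg)
open B8Thm2TorusAt (Thm2TorusAt)
open B9B8CarrierDictionary (liftCfg)
open B8Thm2TorusLettersPerOfKnit (bgY bgY_mem shiftCfg_U₀)
open B8Thm2TorusKnitEstimatesOfMajorants (KnitConstants KnitMajorants B9P3PerAt)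
open B8Thm2TorusLettersTauOfKnit (thm2TorusAt_specialUnitary_ofMajorants_tr)
open B8Thm2SetupTorusOfCubes (pdev_liftCfg_bgY_lt_of_inAk thresholds_of_slack)
open B9KnitMajorantsOfCubeData (knitMajorants_of_cubeData_unitary)
open B7Prop2SpecialUnitary (specialUnitaryUnits specialUnitaryUnits_le_unitaryUnits)
open B7AvgClosedSpecialUnitarySharp (avgClosed_specialUnitary_of_le)
open B8Thm2SetupTorus (Thm2SetupSUAt thm2SetupSUAt_of_thm2TorusAt pow_dvd_period)
open B8Thm2TorusMemberCatalogueThresholds (exists_catalogueF16)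
open scoped Matrix Matrix.Norms.L2Operator

variable {d ℓ : ℕ} {hd : 1 ≤ d + 1} {hL : Odd (ℓ + 1) ∧ 1 < ℓ + 1} {b₀ b₁ : ℝ}

/-! ## §1 ★★★★ FILE 16 §1 with the thresholds before the catalogue -/

section Torus

variable {N : ℕ} [NeZero N]
variable [instF : ∀ i : KIdx d ℓ hd hL b₀ b₁, Fintype (geo9K i).Site] [instD : ∀ i : KIdx d ℓ hd hL b₀ b₁, DecidableEq (geo9K i).Site]

/-- ★★★★ **FILE 16 §1 WITH PRINT's QUANTIFIER ORDER ON THE THRESHOLDS** — [B8] Thm 2 on `T_η` for `SU(N)` (`N ≤ 25`) from the per-cube (3.35) data, the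
(B)-lines and a catalogue: the SAME sentence as `B8Thm2TorusKnitOfCubeData.thm2TorusAt_specialUnitary_ofCubeData` (p33 FILE 16) except that the (3.37) size
`a₁`, the class size `a₀′` and the member thresholds `M₀, T₀, N₀` ([B9] Thm 3.1 «for M ≥ M₁», [4] Lemma 2.1 «for RM satisfying (2.59)») are produced BEFORE the
level slack `e_s` and the catalogue `memF, ιBF` are chosen (`∃ a₁ a₀′ M₀ T₀ N₀, ∀ e_s memF ιBF, ∀ c_L …`) — FILE 16's own proof in this order (the thresholds
come from FILE 15 `knitMajorants_of_cubeData_unitary` and [B7] Prop. 2's constants, the catalogue enters only at seat t2s-1's A5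
`thm2TorusAt_specialUnitary_ofMajorants_tr`).  With this order a catalogue CAN be chosen against the thresholds it must meet (§2).  HONEST SCOPE as FILE 16:
(i)–(iii) displayed, inhabited by nothing here; the [B9] Thm 3.1∕3.2 majorants behind it are FILES 12–14's theorems; count-neutral; `stub_PV3A` NOT
discharged; the Yang–Mills mass gap is NOT proved.
[cite: Balaban1985RegularSpaces, Thm 2 p.83, Thm 4 p.88, (1.7) p.77, p.76, p.77 («Ω_j = T_η»), (1.91)–(1.98) pp.91–92, (1.101) p.93, (1.59) p.86; Balaban1985BackgroundPropagators, Thm 3.1 (3.42) p.397 («for M ≥ M₁»), Thm 3.2 (3.48) p.398, (3.35)–(3.37) p.396, Cor. 3.6 p.408, Thm 3.7 pp.409–410, Thm 3.9 p.413, Thm 3.11 p.416; Balaban1984PropagatorsII, (2.50)–(2.54) pp.232–233, Lemma 2.1 (2.59)–(2.63) pp.233–234; Balaban1985Averaging, Prop. 2 p.26, (52)–(53) pp.26–27; Balaban1983RegularityDecay, Thm (5.8) p.594] -/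
theorem thm2TorusAt_specialUnitary_ofCubeData' (hN : N ≤ 25) (hd2 : 2 ≤ d + 1) (hℓ : 1 ≤ ℓ)
    {B₀ B₀β cB9 βH B₁ : ℝ} {len : LSite (d + 1) → ℝ}
    (hB₀ : 0 < B₀) (hB : 2 ≤ 5 * ((d + 1 : ℕ) : ℝ) * ((ℓ + 1 : ℕ) : ℝ) * B₀) (hcB9 : 0 < cB9)
    (hB₁ : 5 * ((d + 1 : ℕ) : ℝ) * ((ℓ + 1 : ℕ) : ℝ) * B₀ * (1 + 11 * (((d + 1 : ℕ) : ℝ)) ^ 2) < B₁)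
    {ι : Type} [Fintype ι] [DecidableEq ι] (b : Module.Basis ι ℝ (Matrix (Fin N) (Fin N) ℂ)) {M₂ : ℝ} (hM₂ : 0 ≤ M₂)
    (hrepr : ∀ (v : Matrix (Fin N) (Fin N) ℂ) (j : ι), |b.repr v j| ≤ M₂ * ‖v‖) (Rr : ℝ) (Hp : Prop) :
    letI : CStarAlgebra (Matrix (Fin N) (Fin N) ℂ) := {}
    ∃ a₁ : ℝ, 0 < a₁ ∧ ∃ a₀' : ℝ, 0 < a₀' ∧ ∃ M₀ T₀ : ℝ, ∃ N₀ : ℕ,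
    ∀ (es : ℕ) (memF : ℕ → ℤ → ℕ → KIdx d ℓ hd hL b₀ b₁) (ιBF : ∀ k P n, BlkY (memF k P n) → IBondY (memF k P n)),
    ∀ cL : ℝ, 0 < cL → cL * (((ℓ + 1 : ℕ) : ℝ)) ^ (2 * es) < a₀' →
    ∃ B₂ c₁ : ℝ, 0 < B₂ ∧ 0 < c₁ ∧ ∀ (k : ℕ) (P : ℤ) (η : ℝ), 1 ≤ k → 0 < η → (∃ M : ℤ, P = ((ℓ + 1 : ℕ) : ℤ) ^ k * M) →
      (∀ n, 1 ≤ n → n ≤ k → (((PV d ℓ (memF k P n).m (memF k P n).K hd hL).sitesPerDir 0 : ℕ) : ℤ) = P) →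
      (∀ n, 1 ≤ n → n ≤ k → ∀ z : SiteY (memF k P n), levY (memF k P n) z = n) →
      (∀ n, 1 ≤ n → n ≤ k →
        M₀ ≤ ((ℓ : ℝ) + 1) * (toKT (memF k P n)).Mh ∧ N₀ + 1 ≤ (toKT (memF k P n)).R * ((ℓ + 1) * (toKT (memF k P n)).Mh) ∧
        T₀ ≤ RM1 (memF k P n) ∧ (memF k P n).cf = (((ℓ + 1 : ℕ) : ℝ)) ^ (memF k P n).k ∧ (memF k P n).k ≤ n + es ∧
        ∀ s, β (memF k P n).hN (memF k P n).D (memF k P n).hk (ιBF k P n s) = s) →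
      (∀ n, 1 ≤ n → n ≤ k → ∀ ⦃α₀ : ℝ⦄, 0 < α₀ → α₀ ≤ cL → ∀ U₀ : LSite (d + 1) → Fin (d + 1) → (Matrix (Fin N) (Fin N) ℂ)ˣ,
          (∀ x κ, U₀ x κ ∈ specialUnitaryUnits (Fin N)) → (∀ (x : LSite (d + 1)) (μ : Fin (d + 1)), U₀ (x + P • e μ) = U₀ x) →
          InAk (ℓ + 1) n η α₀ (fun _ => (Set.univ : Set (LSite (d + 1)))) U₀ →
          ∃ (g : ↥(cubes (toKT (memF k P n)).D.toDomains) → GaugeY (Matrix (Fin N) (Fin N) ℂ) (memF k P n))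
            (A : ↥(cubes (toKT (memF k P n)).D.toDomains) → AfldY (Matrix (Fin N) (Fin N) ℂ) (memF k P n))
            (Q : ↥(cubes (toKT (memF k P n)).D.toDomains) → Set (Site (PV d ℓ (memF k P n).m (memF k P n).K hd hL) 0))
            (C ξ Λ : ↥(cubes (toKT (memF k P n)).D.toDomains) → ℝ),
            (∀ c x, ‖(g c x : Matrix (Fin N) (Fin N) ℂ)‖ ≤ 1 ∧ ‖(((g c x)⁻¹ : (Matrix (Fin N) (Fin N) ℂ)ˣ) : Matrix (Fin N) (Fin N) ℂ)‖ ≤ 1) ∧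
            (∀ c, 0 ≤ C c) ∧ (∀ c, 0 < ξ c) ∧ (∀ c, 1 ≤ Λ c) ∧ (∀ c, ξ c ≤ 5 * (SC (memF k P n) c : ℝ) * (kGeo (memF k P n)).eta) ∧
            (∀ c, LatticeNorms.scaleLen ((ℓ : ℝ) + 1) (kGeo (memF k P n)).eta (c.1.1 + 1) ≤ Λ c * ξ c) ∧
            (∀ c, ∀ x : Site (PV d ℓ (memF k P n).m (memF k P n).K hd hL) 0,
              NearC (memF k P n) c (35 * SC (memF k P n) c / 8 + 1) (boxEquiv (memF k P n).hN x).1 → x ∈ Q c) ∧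
            (∀ c, ∀ (κ : Fin (d + 1)) (x : Site (PV d ℓ (memF k P n).m (memF k P n).K hd hL) 0), x ∈ Q c → x.shift κ ∈ Q c →
              gaugeY (memF k P n) (g c) (bgY (memF k P n) U₀) κ x = fluct (kGeo (memF k P n)).eta (A c) κ x) ∧
            (∀ c, ∀ κ, ∀ x ∈ Q c, ‖A c κ x‖ ≤ C c * (ξ c)⁻¹) ∧
            (∀ c, ∀ μ ν, ∀ x ∈ Q c,
              ‖(((kGeo (memF k P n)).eta : ℂ)⁻¹) • covD (shiftsV1 (PV d ℓ (memF k P n).m (memF k P n).K hd hL))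
                  (fun _ _ => (1 : (Matrix (Fin N) (Fin N) ℂ)ˣ)) μ (A c ν) x‖ ≤ C c * (ξ c ^ 2)⁻¹) ∧
            (∀ c, max (C c) (C c * (1 + D1 thetaProf)) * Λ c ^ 2 ≤ a₁) ∧ (∀ c, max (C c) (C c * (1 + D1 thetaProf)) * Λ c ^ 2 ≤ 1 / 4)) →
      (∀ m, m ≤ k → ∀ ⦃α₀ : ℝ⦄, 0 < α₀ → α₀ ≤ cL → ∀ U₀ : LSite (d + 1) → Fin (d + 1) → (Matrix (Fin N) (Fin N) ℂ)ˣ,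
          (∀ x κ, U₀ x κ ∈ specialUnitaryUnits (Fin N)) → (∀ (x : LSite (d + 1)) (μ : Fin (d + 1)), U₀ (x + P • e μ) = U₀ x) →
          InAk (ℓ + 1) m η α₀ (fun _ => (Set.univ : Set (LSite (d + 1)))) U₀ →
          B9P3PerAt (𝔸 := Matrix (Fin N) (Fin N) ℂ) (ℓ + 1) B₀ B₀β cB9 βH len η m α₀ P U₀) →
      Thm2TorusAt (ℓ + 1) k P η 0 B₁ B₂ c₁ len (specialUnitaryUnits (Fin N)) (fun _ => True) := by
  letI : CStarAlgebra (Matrix (Fin N) (Fin N) ℂ) := {}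
  haveI : Nonempty (Fin N) := ⟨⟨0, Nat.pos_of_ne_zero (NeZero.ne N)⟩⟩
  have hG : specialUnitaryUnits (Fin N) ≤ unitaryUnits (Matrix (Fin N) (Fin N) ℂ) := specialUnitaryUnits_le_unitaryUnits
  have hGa : AvgClosed (d + 1) (ℓ + 1) (specialUnitaryUnits (Fin N)) := avgClosed_specialUnitary_of_le hN (d + 1) (ℓ + 1)
  -- FILE 15: the `KnitMajorants` package from the per-cube data, for every resummation triple
  obtain ⟨δ, KG, KD, KC, hδ, hKG, hKD, hKC, a₁, ha₁, a₀, ha₀, H⟩ :=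
    knitMajorants_of_cubeData_unitary (hd := hd) (hL := hL) (b₀ := b₀) (b₁ := b₁) b hG hGa
      (fun _ : KIdx d ℓ hd hL b₀ b₁ => Rr) (fun _ : KIdx d ℓ hd hL b₀ b₁ => Hp) hℓ hM₂ hrepr
  -- the resummation triple `(δ₀, βₓ, ρ) := (δ∕4, 1, δ∕2)`
  have hβδ : 0 < (1 : ℝ) * (δ / 4) := by positivity
  obtain ⟨M₀, T₀, N₀, HM⟩ := H (δ / 4) 1 (δ / 2) hβδ (half_pos hδ)
  -- the class size `a₀′ := min(a₀, 1∕(3C₀), c₂′∕2)`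
  have hC0 : 0 < C0 (d + 1) := C0_pos (d + 1)
  have hc2 : 0 < c2' (d + 1) (ℓ + 1) := c2'_pos (d + 1) (ℓ + 1) (Nat.succ_le_succ (Nat.zero_le ℓ))
  set a₀' : ℝ := min a₀ (min (1 / (3 * C0 (d + 1))) (c2' (d + 1) (ℓ + 1) / 2)) with ha₀'_def
  have ha₀' : 0 < a₀' := lt_min ha₀ (lt_min (div_pos one_pos (mul_pos (by norm_num) hC0)) (half_pos hc2))
  have hα3 : C0 (d + 1) * a₀' ≤ 1 / 3 :=
    calc C0 (d + 1) * a₀' ≤ C0 (d + 1) * (1 / (3 * C0 (d + 1))) :=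
          mul_le_mul_of_nonneg_left ((min_le_right _ _).trans (min_le_left _ _)) hC0.le
      _ = 1 / 3 := by field_simp [hC0.ne']
  have hα2 : 2 * a₀' ≤ c2' (d + 1) (ℓ + 1) := by
    have h := (min_le_right a₀ _).trans (min_le_right (1 / (3 * C0 (d + 1))) (c2' (d + 1) (ℓ + 1) / 2))
    linarith
  refine ⟨a₁, ha₁, a₀', ha₀', M₀, T₀, N₀, fun es memF ιBF cL hcL hαe => ?_⟩
  obtain ⟨hc3, hc2'⟩ := thresholds_of_slack (d := d) hcL.le hαe hα3 hα2
  -- the uniform constants: budget `ρ + 2βₓδ₀ = δ`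
  have cst : KnitConstants b M₂ (δ / 4) δ 1 (δ / 2) KG KD KC :=
    { hM₂ := hM₂, hrepr := hrepr, hA := hKG, hA₁ := hKD, hK := hKC, hρ := (half_pos hδ).le, hβ := zero_le_one,
      hδ₀ := by positivity, hr := le_of_eq (by ring) }
  -- the five internal windows (file A9's `max … 0 ∕ 1` pattern)
  set d₁ : ℕ := exp261 (geo9K (d := d) (ℓ := ℓ) (hd := hd) (hL := hL) (b₀ := b₀) (b₁ := b₁)) (δ / 4) 1 with hd₁
  set c : ℝ := B6.c1 (exp261 (geo9K (d := d) (ℓ := ℓ) (hd := hd) (hL := hL) (b₀ := b₀) (b₁ := b₁)) (δ / 2) 1) (δ / 2) 1 with hc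
  set S : ℝ := ∑ j, ‖b j‖ with hS
  set BG : ℝ := max (max (S * KG * c * M₂) (S * KD * c * M₂)) 0 with hBG_def
  set BH : ℝ := max (max (S * (((M₂ * S) * KG * KG * KC * B6.c1 d₁ (δ / 4) 1 ^ 2) * c * M₂))
    (S * (((M₂ * S) * KD * KG * KC * B6.c1 d₁ (δ / 4) 1 ^ 2) * c * M₂))) 1 with hBH_def
  set B₂' : ℝ := max (S * (((M₂ * S) * KG * KC * B6.c1 d₁ (δ / 4) 1) * c * M₂)
    + S * (((M₂ * S) * KG * KG * KC * B6.c1 d₁ (δ / 4) 1 ^ 2) * c * M₂)) 0 with hB₂'_def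
  set BR : ℝ := max (1 + S * (((M₂ * S) ^ 2 * KG * KC * KG * B6.c1 d₁ (δ / 4) 1 ^ 2) * c * M₂)) 0 with hBR_def
  set B₀' : ℝ := max (3 * (2 * ((d + 1 : ℕ) : ℝ) * (((ℓ + 1 : ℕ) : ℝ)) ^ 2) * BG * (BR + 2)) 1 with hB₀'_def
  have hBG : 0 ≤ BG := le_max_right _ _
  have hBH : 0 < BH := lt_of_lt_of_le one_pos (le_max_right _ _)
  have hB₂' : 0 ≤ B₂' := le_max_right _ _
  have hBR : 0 ≤ BR := le_max_right _ _
  have hB₀' : 0 < B₀' := lt_of_lt_of_le one_pos (le_max_right _ _)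
  have hfree : 3 * (2 * ((d + 1 : ℕ) : ℝ) * (((ℓ + 1 : ℕ) : ℝ)) ^ 2) * BG * (BR + 2) ≤ B₀' := le_max_left _ _
  have hBGe : S * KG * c * M₂ ≤ BG := (le_max_left _ _).trans (le_max_left _ _)
  have hBG₁ : S * KD * c * M₂ ≤ BG := (le_max_right _ _).trans (le_max_left _ _)
  have hBHe : S * (((M₂ * S) * KG * KG * KC * B6.c1 d₁ (δ / 4) 1 ^ 2) * c * M₂) ≤ BH := (le_max_left _ _).trans (le_max_left _ _)
  have hBH₁ : S * (((M₂ * S) * KD * KG * KC * B6.c1 d₁ (δ / 4) 1 ^ 2) * c * M₂) ≤ BH := (le_max_right _ _).trans (le_max_left _ _)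
  have hB₂e : S * (((M₂ * S) * KG * KC * B6.c1 d₁ (δ / 4) 1) * c * M₂)
      + S * (((M₂ * S) * KG * KG * KC * B6.c1 d₁ (δ / 4) 1 ^ 2) * c * M₂) ≤ B₂' := le_max_left _ _
  have hBRe : 1 + S * (((M₂ * S) ^ 2 * KG * KC * KG * B6.c1 d₁ (δ / 4) 1 ^ 2) * c * M₂) ≤ BR := le_max_left _ _
  -- file A5's endpoint at these constants
  obtain ⟨B₂, c₁, hB₂pos, hc₁, Hτ⟩ :=
    thm2TorusAt_specialUnitary_ofMajorants_tr (len := len) (B₀β := B₀β) (β := βH) hN hd2 hB₀ hB₀' hB hBH hB₂' hBG hBR hcB9 hcL hfree hB₁ hc3 hc2'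
      cst hBGe hBG₁ hBHe hBH₁ hB₂e hBRe memF ιBF Rr Hp (fun k P n => (etaS (memF k P n) ^ 2 * etaS (memF k P n) ^ 2)⁻¹)
  refine ⟨B₂, c₁, hB₂pos, hc₁, fun k P η hk hη hPk hP hlev hcat hdata hb9 => Hτ k P η hk hη hPk hP hlev ?_ hb9⟩
  intro n hn hnk α₀ hα hαc U₀ hU₀G hU₀per hA
  obtain ⟨hM, hNR, hT, hcf, hke, hι⟩ := hcat n hn hnk
  obtain ⟨g, A, Q, C, ξ, Λ, hu, hCn, hξ, hΛ, hξS, hΛξ, hQ, hgA, hAb, hdA, hα₁, hα4⟩ := hdata n hn hnk hα hαc U₀ hU₀G hU₀per hA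
  have hshift := shiftCfg_U₀ (memF k P) U₀ hP hU₀per hn hnk
  have h52 : pdev (liftCfg (bgY (memF k P n) U₀)) < a₀' * ((((ℓ + 1 : ℕ) : ℝ) ^ (memF k P n).k)⁻¹) ^ 2 :=
    pdev_liftCfg_bgY_lt_of_inAk (memF k P n) hke hshift hα.le hαc hαe hA
  exact HM a₀' ha₀' (min_le_left _ _) hα3 hα2 (memF k P n) hM hNR hT hcf (ιBF k P n) hι (bgY (memF k P n) U₀)
    (bgY_mem (memF k P n) hU₀G) h52 g hu A Q C ξ Λ hCn hξ hΛ hξS hΛξ hQ hgA hAb hdA hα₁ hα4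
    (B := ⟨PUnit, PUnit.unit, fun _ _ => PUnit.unit, fun _ _ _ => True, fun _ _ _ => True, fun _ _ _ => True, fun _ _ _ => True⟩)
    (fun _ => bgY (memF k P n) U₀) PUnit.unit rfl

end Torus

/-! ## §2 ★★★★ The Setup-torus form with the catalogue DISCHARGED (per-cube data member-generic) -/

section Setup

variable {N : ℕ} [NeZero N]
variable [instF : ∀ i : KIdx d ℓ hd hL b₀ b₁, Fintype (geo9K i).Site] [instD : ∀ i : KIdx d ℓ hd hL b₀ b₁, DecidableEq (geo9K i).Site]

/-- ★★★★ **[B8] THM 2 AT THE `SU(N)`-VALUED SETUP-TORUS OBJECTS OF EVERY `PV d ℓ m K` WITH `k + k₀ ≤ m + K`, FROM THE PER-CUBE (3.35) DATA AND THE (B)-LINES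
ALONE — the member catalogue CONSTRUCTED (G1) against the thresholds of §1** (`1 ≤ N ≤ 25`, `d + 1 ≥ 2`, odd `L = ℓ + 1 ≥ 5`, band `0 < b₀ ≤ b₁`):
`∃ a₁ > 0` (the (3.37) size), `∃ a₀′ > 0` (the class size), `∃ a k₀` (`L^a ≥ 8`, the catalogue's big-block exponent and located volume threshold) such that for
every `c_L > 0` with `c_L·L² < a₀′` there are `B₁ B₂ c₁ > 0` such that for EVERY volume `m`, number of steps `K`, level `1 ≤ k` with `k + k₀ ≤ m + K`, `η > 0`,
at `P₀ = sitesPerDir 0` of `PV d ℓ m K`: [for every member `i` of the catalogue's SHAPE — constant level `n ≤ k` (`1 ≤ n`), nominal index `n + 1`, `M_h = L^a`,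
`c_f = L^{n+1}`, period `P₀` — every `0 < α₀ ≤ c_L` and every `SU(N)`-valued `P₀`-periodic `U₀ ∈ 𝔄_n(T_η, α₀)`: a family of per-cube (3.35) data for `bgY i U₀`
(bi-contractive gauges `u_□`, potentials `A_□` on torus sets `Q_□ ⊇ NearC_□(35S_j∕8 + 1)`, sizes `C, ξ, Λ`, the nine (3.35) clauses, the (3.37) sizes `≤ a₁`,
`≤ ¼` — FILE 16's clauses verbatim)] → [(B)-lines `B9P3PerAt` at every `m′ ≤ k`, `α₀ ≤ c_L`] → `Thm2SetupSUAt (PV d ℓ m K hd hL) N k η 0 B₁ B₂ c₁ len (fun _ => True)`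
(`β₀ = 0`, `B₁ = 5(d+1)LB₀(1 + 11(d+1)²) + 1`, `B₁, c₁` uniform — the shape `Prop7SPrintThm2Dict.prop2Printed_sPrint_of_thm2SetupSUAt` reads).  HONEST SCOPE: both
arrows' antecedents displayed, inhabited by nothing here; no estimate of [B8] proved in this file; `stub_PV3A` NOT discharged; the Yang–Mills mass gap is NOT
proved.
[cite: Balaban1985RegularSpaces, Thm 2 p.83 («there exists B₁ such that the above theorem holds»), (1.33)–(1.39) pp.82–83, p.77 («Ω_j = T_η»), p.76 («G = SU(N)»), (1.59) p.86; Balaban1985BackgroundPropagators, Thm 3.1 (3.42) p.397 («for M ≥ M₁»), Thm 3.2 (3.48) p.398, (3.35)–(3.37) p.396, Thm 3.7 pp.409–410, Thm 3.9 p.413; Balaban1985Averaging, (4) p.18, Prop. 2 p.26; Balaban1984PropagatorsII, (2.1)–(2.4) p.224, Lemma 2.1 (2.59)–(2.61) pp.233–234] -/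
theorem thm2SetupSUAt_ofCubeData_catalogued_exists (hN : N ≤ 25) (hd2 : 2 ≤ d + 1) (hℓ : 4 ≤ ℓ) (hb₀ : 0 < b₀) (hb₁ : b₀ ≤ b₁)
    {B₀ B₀β cB9 βH : ℝ} {len : LSite (d + 1) → ℝ}
    (hB₀ : 0 < B₀) (hB : 2 ≤ 5 * ((d + 1 : ℕ) : ℝ) * ((ℓ + 1 : ℕ) : ℝ) * B₀) (hcB9 : 0 < cB9)
    {ι : Type} [Fintype ι] [DecidableEq ι] (b : Module.Basis ι ℝ (Matrix (Fin N) (Fin N) ℂ)) {M₂ : ℝ} (hM₂ : 0 ≤ M₂)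
    (hrepr : ∀ (v : Matrix (Fin N) (Fin N) ℂ) (j : ι), |b.repr v j| ≤ M₂ * ‖v‖) (Rr : ℝ) (Hp : Prop) :
    letI : CStarAlgebra (Matrix (Fin N) (Fin N) ℂ) := {}
    ∃ a₁ : ℝ, 0 < a₁ ∧ ∃ a₀' : ℝ, 0 < a₀' ∧ ∃ a k₀ : ℕ, 8 ≤ (ℓ + 1) ^ a ∧
    ∀ cL : ℝ, 0 < cL → cL * (((ℓ + 1 : ℕ) : ℝ)) ^ 2 < a₀' →
    ∃ B₁ B₂ c₁ : ℝ, 0 < B₁ ∧ 0 < B₂ ∧ 0 < c₁ ∧ ∀ (m K k : ℕ) (η : ℝ), 1 ≤ k → k + k₀ ≤ m + K → 0 < η →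
      (∀ (i : KIdx d ℓ hd hL b₀ b₁) (n : ℕ), 1 ≤ n → n ≤ k → (∀ x, i.D.lev x = n) → i.k = n + 1 → i.Mh = (ℓ + 1) ^ a →
        i.cf = (((ℓ + 1 : ℕ) : ℝ)) ^ (n + 1) → (PV d ℓ i.m i.K hd hL).sitesPerDir 0 = (PV d ℓ m K hd hL).sitesPerDir 0 →
        ∀ ⦃α₀ : ℝ⦄, 0 < α₀ → α₀ ≤ cL → ∀ U₀ : LSite (d + 1) → Fin (d + 1) → (Matrix (Fin N) (Fin N) ℂ)ˣ,
          (∀ x κ, U₀ x κ ∈ specialUnitaryUnits (Fin N)) →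
          (∀ (x : LSite (d + 1)) (μ : Fin (d + 1)), U₀ (x + (((PV d ℓ m K hd hL).sitesPerDir 0 : ℕ) : ℤ) • e μ) = U₀ x) →
          InAk (ℓ + 1) n η α₀ (fun _ => (Set.univ : Set (LSite (d + 1)))) U₀ →
          ∃ (g : ↥(cubes (toKT i).D.toDomains) → GaugeY (Matrix (Fin N) (Fin N) ℂ) i)
            (A : ↥(cubes (toKT i).D.toDomains) → AfldY (Matrix (Fin N) (Fin N) ℂ) i)
            (Q : ↥(cubes (toKT i).D.toDomains) → Set (Site (PV d ℓ i.m i.K hd hL) 0))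
            (C ξ Λ : ↥(cubes (toKT i).D.toDomains) → ℝ),
            (∀ c x, ‖(g c x : Matrix (Fin N) (Fin N) ℂ)‖ ≤ 1 ∧ ‖(((g c x)⁻¹ : (Matrix (Fin N) (Fin N) ℂ)ˣ) : Matrix (Fin N) (Fin N) ℂ)‖ ≤ 1) ∧
            (∀ c, 0 ≤ C c) ∧ (∀ c, 0 < ξ c) ∧ (∀ c, 1 ≤ Λ c) ∧ (∀ c, ξ c ≤ 5 * (SC i c : ℝ) * (kGeo i).eta) ∧
            (∀ c, LatticeNorms.scaleLen ((ℓ : ℝ) + 1) (kGeo i).eta (c.1.1 + 1) ≤ Λ c * ξ c) ∧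
            (∀ c, ∀ x : Site (PV d ℓ i.m i.K hd hL) 0, NearC i c (35 * SC i c / 8 + 1) (boxEquiv i.hN x).1 → x ∈ Q c) ∧
            (∀ c, ∀ (κ : Fin (d + 1)) (x : Site (PV d ℓ i.m i.K hd hL) 0), x ∈ Q c → x.shift κ ∈ Q c →
              gaugeY i (g c) (bgY i U₀) κ x = fluct (kGeo i).eta (A c) κ x) ∧
            (∀ c, ∀ κ, ∀ x ∈ Q c, ‖A c κ x‖ ≤ C c * (ξ c)⁻¹) ∧
            (∀ c, ∀ μ ν, ∀ x ∈ Q c,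
              ‖(((kGeo i).eta : ℂ)⁻¹) • covD (shiftsV1 (PV d ℓ i.m i.K hd hL)) (fun _ _ => (1 : (Matrix (Fin N) (Fin N) ℂ)ˣ)) μ (A c ν) x‖ ≤
                C c * (ξ c ^ 2)⁻¹) ∧
            (∀ c, max (C c) (C c * (1 + D1 thetaProf)) * Λ c ^ 2 ≤ a₁) ∧ (∀ c, max (C c) (C c * (1 + D1 thetaProf)) * Λ c ^ 2 ≤ 1 / 4)) →
      (∀ m', m' ≤ k → ∀ ⦃α₀ : ℝ⦄, 0 < α₀ → α₀ ≤ cL → ∀ U₀ : LSite (d + 1) → Fin (d + 1) → (Matrix (Fin N) (Fin N) ℂ)ˣ,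
          (∀ x κ, U₀ x κ ∈ specialUnitaryUnits (Fin N)) →
          (∀ (x : LSite (d + 1)) (μ : Fin (d + 1)), U₀ (x + (((PV d ℓ m K hd hL).sitesPerDir 0 : ℕ) : ℤ) • e μ) = U₀ x) →
          InAk (ℓ + 1) m' η α₀ (fun _ => (Set.univ : Set (LSite (d + 1)))) U₀ →
          B9P3PerAt (𝔸 := Matrix (Fin N) (Fin N) ℂ) (ℓ + 1) B₀ B₀β cB9 βH len η m' α₀ (((PV d ℓ m K hd hL).sitesPerDir 0 : ℕ) : ℤ) U₀) →
      Thm2SetupSUAt (PV d ℓ m K hd hL) N k η 0 B₁ B₂ c₁ len (fun _ => True) := by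
  letI : CStarAlgebra (Matrix (Fin N) (Fin N) ℂ) := {}
  have hB₁ : 5 * ((d + 1 : ℕ) : ℝ) * ((ℓ + 1 : ℕ) : ℝ) * B₀ * (1 + 11 * (((d + 1 : ℕ) : ℝ)) ^ 2)
      < 5 * ((d + 1 : ℕ) : ℝ) * ((ℓ + 1 : ℕ) : ℝ) * B₀ * (1 + 11 * (((d + 1 : ℕ) : ℝ)) ^ 2) + 1 := lt_add_one _
  have hB₁pos : 0 < 5 * ((d + 1 : ℕ) : ℝ) * ((ℓ + 1 : ℕ) : ℝ) * B₀ * (1 + 11 * (((d + 1 : ℕ) : ℝ)) ^ 2) + 1 := by positivity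
  obtain ⟨a₁, ha₁, a₀', ha₀', M₀, T₀, N₀, H⟩ :=
    thm2TorusAt_specialUnitary_ofCubeData' (hd := hd) (hL := hL) (b₀ := b₀) (b₁ := b₁) (len := len) (B₀β := B₀β) (βH := βH) hN hd2 (by omega)
      hB₀ hB hcB9 hB₁ b hM₂ hrepr Rr Hp
  -- G1: the catalogue against these thresholds
  obtain ⟨a, k₀, memF, ιBF, h8, hk₀, Hcat⟩ := exists_catalogueF16 (d := d) (hd := hd) (hL := hL) hℓ hb₀ hb₁ M₀ T₀ N₀
  refine ⟨a₁, ha₁, a₀', ha₀', a, k₀, h8, fun cL hcL hαe => ?_⟩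
  obtain ⟨B₂, c₁, hB₂, hc₁, HT⟩ := H 1 memF ιBF cL hcL (by simpa using hαe)
  refine ⟨_, B₂, c₁, hB₁pos, hB₂, hc₁, fun m K k η hk hkK hη hdata hb9 => ?_⟩
  obtain ⟨hshape, hP, hlev, hcat⟩ := Hcat m K k hk hkK
  refine thm2SetupSUAt_of_thm2TorusAt
    (HT k _ η hk hη (pow_dvd_period (PV d ℓ m K hd hL) (j := 0) (by simpa using (show k ≤ m + K by omega))) hP hlev hcat ?_ hb9)
  intro n hn hnk α₀ hα hαc U₀ hU₀G hU₀per hA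
  obtain ⟨hD, hkn, hMh, hcf, hper, -⟩ := hshape n hn hnk
  exact hdata _ n hn hnk hD hkn hMh hcf hper hα hαc U₀ hU₀G hU₀per hA

end Setup

end Literature.MathematicalPhysics.QuantumFieldTheory.Balaban1983to89.B8Thm2TorusKnitOfCubeDataCatalogued

end
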